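import Literature.IUT.HodgeArakelov.IotaInvariantThetaInftyDivisible
import Literature.AnabelianGeometry.EtaleTheta.Discharge.Sec2ThetaOrbitClasses
import Literature.AnabelianGeometry.EtaleTheta.SettingGaloisFacts
import Literature.IUT.LogVolume.UnitsModPowFinite
import Literature.IUT.LogVolume.PadicSubfields
import Mathlib.Tactic.Module

/-!
# [IUTchII] Prop 2.2 (ii) «respectively» clause AT THE MODEL: the orbit of `η̲̈^Θ` is FINITE modulo `N`
# ([EtTh] Prop 1.5 (iii) + finiteness of `O^×_K̈/(O^×_K̈)^{lN}`), hence (hdiv) and the clause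

S. Mochizuki, *Inter-universal Teichmüller theory II*, kurims manuscript (Dec. 2020), §2 Prop. 2.2 (ii) p. 66;
S. Mochizuki, *The étale theta function …* [EtTh], Publ. RIMS **45** (2009), §1 Prop. 1.5 (iii) p. 23: "any
class `η̈^Θ ∈ H¹(Π^tp_Ÿ, Δ_Θ)` arises from a unique class `η̈^Θ ∈ H¹((Π^tp_Ÿ)^Θ, Δ_Θ)` … on which `a ∈ Z ≅ Π^tp_X/Π^tp_Y`
acts as follows: `η̈^Θ ↦ η̈^Θ − 2a·log(Ü) − (a²/2)·log(q_X) + log(O^×_K̈)`" [claim: Mochizuki2012, status: disputed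
for the [IUTchII] reading; [EtTh] is refereed]. abc-iut cell, layer L6, node IUTchII:Prop2.2(ii), sub-DAG row
Prop-22.ii.r13a (abc-iut-w5-d187). `IotaInvariantThetaInftyDivisible.lean` reduced the binder (hdiv) of the clause
at the model `D := etaleThetaDataOfSetting'` to `hfin`: for each `N`, the `Π^tp_X̲̲`-conjugates `σ·η̲̈^Θ` of the root
cocycle take finitely many values modulo `N`-th powers on `Π^tp_Ÿ̲̲ ∩ chiKer(lN)`. THIS FILE proves `hfin` from the
NAMED fact `ThetaSetting.Prop15iii` (F-0591) and the CLASSICAL finiteness of `O^×_K̈/(O^×_K̈)^{lN}`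
(`Literature.IUT.LogVolume.exists_finset_units_eq_mul_pow`, Neukirch II (5.7)): two conjugates `σ·η̈^Θ`, `σ₀·η̈^Θ`
with `a(σ) ≡ a(σ₀) mod lN` and `u_σ ≡ u_{σ₀} mod (O^×_K̈)^{lN}` differ, as classes, by an `(lN)`-th power
(`conj_etaDd_eq_mul_pow`), hence pointwise on `Π^tp_Ÿ̲̲ ∩ chiKer(lN)` by `(lN)`-th powers of elements of `Δ_Θ`
(coboundaries of `Δ_Θ` are `(lN)`-th powers there: `conj_mul_inv_mem_pow_deltaTheta`), i.e. by `N`-th powers in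
`l·Δ_Θ`; the invariant `(a(σ) mod lN, class of u_σ)` has finitely many values.

Main results: `hfin_etaleThetaDataOfSetting'` (orbit finiteness), `hdiv_etaleThetaDataOfSetting'` ((hdiv) proved),
**`inftyClause_etaleThetaDataOfSetting'_of_prop15iii`** — the «respectively» clause of [IUTchII] Prop. 2.2 (ii)
at the model modulo ONLY: (hfix) [cyclotomic character; abc-iut-w4-d041], F-0591 `Prop15iii`, the cyclotome
identifications `CyclotomeMod` (L2 data), the origin guard `IsEtThOrigin` (F-2498), and the structural input
"`Δ_Θ` compact, `(Π^tp_X)^Θ` Hausdorff" ([EtTh] p. 12). Proof-only; nothing of [IUTchII]/[EtTh] asserted; no side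
taken on [IUTchIII] Cor. 3.12.
-/

namespace Literature.IUT.HodgeArakelov

open Literature.AnabelianGeometry.EtaleTheta Literature.AnabelianGeometry.SemiGraphs
open CohomologySystemOfContH1 EtaleThetaDataOfSetting DivisibleLevel
open Literature.IUT.LogVolume

noncomputable section

namespace EtaleThetaDataOfSetting

variable {p : ℕ} [Fact p.Prime] {D : Literature.AnabelianGeometry.EtaleTheta.ThetaSetting p}
  {E : D.EtaleThetaData} {l : ℕ} (C : E.DoubleUnderline l)

open scoped IsMulCommutative

/-! ### The algebra of [EtTh] Prop. 1.5 (iii): congruent parameters give an `M`-th power -/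

/-- In a commutative group: if `c = x·L^{-2a}·Q^{-a²}·(κ_s κ_v^M)` and `c₀ = x·L^{-2a₀}·Q^{-a₀²}·(κ_s κ_{v₀}^M)`
with `a = a₀ + M k`, then `c = c₀ · w^M` for an explicit `w`. [cite: MochizukiEtTh2009, Prop 1.5 (iii) p.23] -/
theorem eq_mul_pow_of_translate {Γ : Type*} [CommGroup Γ] (x L Q κs κv κv₀ c c₀ : Γ) (a₀ k : ℤ) (M : ℕ)
    (hc : c = x * (L ^ (-(2 * (a₀ + M * k))) * Q ^ (-((a₀ + M * k) * (a₀ + M * k))) * (κs * κv ^ M)))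
    (hc₀ : c₀ = x * (L ^ (-(2 * a₀)) * Q ^ (-(a₀ * a₀)) * (κs * κv₀ ^ M))) :
    c = c₀ * (L ^ (-(2 * k)) * Q ^ (-(k * (a₀ + M * k + a₀))) * (κv * κv₀⁻¹)) ^ M := by
  rw [hc, hc₀]
  apply (Additive.ofMul : Γ ≃ Additive Γ).injective
  simp only [ofMul_mul, ofMul_inv, ofMul_zpow, ofMul_pow]
  module

/-! ### Coboundaries of `Δ_Θ` are `(M)`-th powers on `chiKer M` -/

/-- On `chiKer M` every element of `Π^tp_X̲̲` moves every `e ∈ Δ_Θ` by an `M`-th power: `(ᵍe)e⁻¹ = z^M`, `z ∈ Δ_Θ`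
(apply the mod-`M` triviality on `l·Δ_Θ` to `e^l` and use that `Δ_Θ` has no `l`-torsion).
[cite: MochizukiEtTh2009, Def 2.13 p.46] -/
theorem conj_mul_inv_eq_pow_deltaTheta (hO : D.IsEtThOrigin) {M : ℕ+} (μ : D.CyclotomeMod l M) {g : Pi C}
    (hg : g ∈ chiKer C M) (e : D.DeltaTheta) :
    ∃ z : D.DeltaTheta, MulAut.conjNormal (phi C g) e * e⁻¹ = z ^ (M : ℕ) := by
  have hl0 : l ≠ 0 := C.l_ne_zero
  let b : D.lDeltaTheta l := ⟨(e : D.GtpTheta) ^ l, e, e.2, rfl⟩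
  obtain ⟨y, hy⟩ := conj_mul_inv_mem_range_pow C μ hg b
  obtain ⟨z₀, hz₀, hz₀y⟩ := y.2
  refine ⟨⟨z₀, hz₀⟩, ?_⟩
  -- compare `l`-th powers in the torsion-free `Δ_Θ`
  have htf : ∀ a : D.DeltaTheta, a ^ l = 1 → a = 1 := fun a ha =>
    Subtype.ext (D.deltaTheta_torsionfree hO a.2 hl0 (by rw [← Subgroup.coe_pow, ha]; rfl))
  apply eq_of_pow_eq htf
  apply Subtype.ext
  have hy' : ((y ^ (M : ℕ) : D.lDeltaTheta l) : D.GtpTheta) =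
      ((MulAut.conjNormal (phi C g) b * b⁻¹ : D.lDeltaTheta l) : D.GtpTheta) := congrArg Subtype.val hy
  have hb : ((b : D.lDeltaTheta l) : D.GtpTheta) = (e : D.GtpTheta) ^ l := rfl
  simp only [Subgroup.coe_mul, Subgroup.coe_inv, Subgroup.coe_pow, MulAut.conjNormal_apply, hb] at hy' ⊢
  rw [← hz₀y] at hy'
  -- `hy' : (z₀^l)^M = φg e^l φg⁻¹ (e^l)⁻¹`; goal: `(φg e φg⁻¹ e⁻¹)^l = (z₀^M)^l`
  rw [← pow_mul, mul_comm, pow_mul, hy', ← conj_pow, ← inv_pow]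
  have hcomm : Commute ((phi C) g * ↑e * ((phi C) g)⁻¹) (↑e)⁻¹ := by
    have h1 : (phi C) g * ↑e * ((phi C) g)⁻¹ ∈ D.DeltaTheta := D.deltaTheta_normal.conj_mem _ e.2 _
    exact D.ker_thetaToEll_comm _ h1 _ (inv_mem e.2)
  rw [hcomm.mul_pow]

/-! ### The orbit of `η̲̈^Θ` has finitely many members modulo `N` -/

/-- **Two conjugates of the lifted theta class with congruent parameters differ by an `M`-th power**
([EtTh] Prop. 1.5 (iii)): if `a(σ) = a(σ₀) + Mk` in `Z` and the units `u_σ = s·v^M`, `u_{σ₀} = s·v₀^M` have the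
same representative `s`, then `σ·η̈^Θ = σ₀·η̈^Θ · y^M` in `H¹(Π^tp_Ÿ, Δ_Θ)` for some class `y`.
[cite: MochizukiEtTh2009, Prop 1.5 (iii) p.23] -/
theorem conj_etaDd_eq_mul_pow (hC : D.Compat) {x' : D.H1Theta (D.GtpYdd.map D.toTheta)}
    (hx' : D.inflTheta D.GtpYdd x' = E.etaDd) {σ σ₀ : D.PiTemp} {uσ uσ₀ sU vU vU₀ : (↥D.Kdd)ˣ} {M : ℕ}
    {k : ℤ} (ha : Multiplicative.toAdd (D.toZ σ) = Multiplicative.toAdd (D.toZ σ₀) + M * k)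
    (huσ : uσ = sU * vU ^ M) (huσ₀ : uσ₀ = sU * vU₀ ^ M)
    (hσ : haveI := hC.GtpYddTheta_normal
      ContH1.conj (MonoidHom.id D.GtpTheta) D.DeltaTheta (D.toTheta σ) x' =
        x' * (E.logUdd ^ (-(2 * Multiplicative.toAdd (D.toZ σ)))
          * E.kumYdd (E.toKddHat D.qddUnit) ^ (-(Multiplicative.toAdd (D.toZ σ) * Multiplicative.toAdd (D.toZ σ)))
          * E.kumYdd (E.toKddHat uσ)))
    (hσ₀ : haveI := hC.GtpYddTheta_normal
      ContH1.conj (MonoidHom.id D.GtpTheta) D.DeltaTheta (D.toTheta σ₀) x' =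
        x' * (E.logUdd ^ (-(2 * Multiplicative.toAdd (D.toZ σ₀)))
          * E.kumYdd (E.toKddHat D.qddUnit) ^ (-(Multiplicative.toAdd (D.toZ σ₀) * Multiplicative.toAdd (D.toZ σ₀)))
          * E.kumYdd (E.toKddHat uσ₀))) :
    ∃ y : D.H1 D.GtpYdd,
      haveI := hC.GtpYdd_normal
      ContH1.conj D.toTheta D.DeltaTheta σ E.etaDd = ContH1.conj D.toTheta D.DeltaTheta σ₀ E.etaDd * y ^ M := by
  haveI := hC.GtpYdd_normal
  haveI := hC.GtpYddTheta_normal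
  rw [huσ, map_mul, map_mul, map_pow, map_pow] at hσ
  rw [huσ₀, map_mul, map_mul, map_pow, map_pow] at hσ₀
  rw [ha] at hσ
  set w : D.H1Theta (D.GtpYdd.map D.toTheta) :=
    E.logUdd ^ (-(2 * k)) *
      E.kumYdd (E.toKddHat D.qddUnit) ^ (-(k * (Multiplicative.toAdd (D.toZ σ₀) + M * k +
        Multiplicative.toAdd (D.toZ σ₀)))) *
      (E.kumYdd (E.toKddHat vU) * (E.kumYdd (E.toKddHat vU₀))⁻¹) with hw
  have key := eq_mul_pow_of_translate x' E.logUdd (E.kumYdd (E.toKddHat D.qddUnit))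
    (E.kumYdd (E.toKddHat sU)) (E.kumYdd (E.toKddHat vU)) (E.kumYdd (E.toKddHat vU₀)) _ _
    (Multiplicative.toAdd (D.toZ σ₀)) k M hσ hσ₀
  refine ⟨D.inflTheta D.GtpYdd w, ?_⟩
  have e1 : ContH1.conj D.toTheta D.DeltaTheta σ E.etaDd =
      D.inflTheta D.GtpYdd (ContH1.conj (MonoidHom.id D.GtpTheta) D.DeltaTheta (D.toTheta σ) x') := by
    rw [← hx']
    exact (ContH1.infl_conj (H₀ := D.GtpYdd) (H' := D.GtpYdd.map D.toTheta)
      (hψ := D.continuous_toTheta) le_rfl σ x').symm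
  have e2 : ContH1.conj D.toTheta D.DeltaTheta σ₀ E.etaDd =
      D.inflTheta D.GtpYdd (ContH1.conj (MonoidHom.id D.GtpTheta) D.DeltaTheta (D.toTheta σ₀) x') := by
    rw [← hx']
    exact (ContH1.infl_conj (H₀ := D.GtpYdd) (H' := D.GtpYdd.map D.toTheta)
      (hψ := D.continuous_toTheta) le_rfl σ₀ x').symm
  rw [e1, e2, key, map_mul, map_pow]

/-- The conjugate root cocycle, evaluated and coerced to `(Π^tp_X)^Θ`:
`(σ·η̲̈^Θ)(g) = θ(σ) · η̲̈^Θ(σ⁻¹gσ) · θ(σ)⁻¹`. [cite: MochizukiEtTh2009, Def 2.7 p.41] -/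
theorem inclusion_conjCocycle_rootLiftCocycle_apply (hC : D.Compat) (σ : Pi C) (g : ↥(PiYdd C ⊓ ⊤)) :
    haveI := piYdd_normal C hC
    Subgroup.inclusion (D.lDeltaTheta_le l)
        ((ContH1.conjCocycle (phi C) (D.lDeltaTheta l) σ (rootLiftCocycle C)).1 g) =
      MulAut.conjNormal (D.toTheta (σ : D.PiTemp))
        ((rootLift C).1 (toYdduu C ⊤ (MulAut.conjNormal σ⁻¹ g))) := by
  haveI := piYdd_normal C hC
  apply Subtype.ext
  simp only [ContH1.conjCocycle_apply, Subgroup.coe_inclusion, MulAut.conjNormal_apply]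
  rfl

/-- **Pointwise comparison of two conjugates of the root cocycle.** If `σ·η̈^Θ = σ₀·η̈^Θ · y^M` as classes on
`Π^tp_Ÿ` (`M = lN`), then at every `g ∈ Π^tp_Ÿ̲̲ ∩ chiKer(M)` the `l·Δ_Θ`-valued conjugate root cocycles satisfy
`(σ₀·η̲̈^Θ)(g)⁻¹ · (σ·η̲̈^Θ)(g) ∈ (l·Δ_Θ)^N` — the class identity holds pointwise up to coboundaries of `Δ_Θ`, which
are `M`-th powers on `chiKer(M)`. [cite: MochizukiEtTh2009, Prop 1.5 (iii) p.23] -/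
theorem conj_rootLift_div_mem_range_pow (hC : D.Compat) (hO : D.IsEtThOrigin) {M : ℕ+} (μ : D.CyclotomeMod l M)
    {N : ℕ} (hMN : (M : ℕ) = l * N) {σ σ₀ : Pi C} (y : D.H1 D.GtpYdd)
    (hy : haveI := hC.GtpYdd_normal
      ContH1.conj D.toTheta D.DeltaTheta (σ : D.PiTemp) E.etaDd =
        ContH1.conj D.toTheta D.DeltaTheta (σ₀ : D.PiTemp) E.etaDd * y ^ (M : ℕ))
    (g : ↥(PiYdd C ⊓ ⊤)) (hg : (g : Pi C) ∈ chiKer C M) :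
    haveI := piYdd_normal C hC
    ((ContH1.conjCocycle (phi C) (D.lDeltaTheta l) σ₀ (rootLiftCocycle C)).1 g)⁻¹ *
        (ContH1.conjCocycle (phi C) (D.lDeltaTheta l) σ (rootLiftCocycle C)).1 g ∈
      (powMonoidHom N : D.lDeltaTheta l →* D.lDeltaTheta l).range := by
  haveI := piYdd_normal C hC
  haveI := hC.GtpYdd_normal
  -- cocycle representatives of `η̈^Θ` and of `y`
  obtain ⟨ee, hee⟩ := QuotientGroup.mk_surjective E.etaDd
  obtain ⟨ww, hww⟩ := QuotientGroup.mk_surjective y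
  -- (iii) the class identity, pointwise up to a coboundary `∂b`
  have hcl : (QuotientGroup.mk (ContH1.conjCocycle D.toTheta D.DeltaTheta (σ₀ : D.PiTemp) ee * ww ^ (M : ℕ)) :
      D.H1 D.GtpYdd) = QuotientGroup.mk (ContH1.conjCocycle D.toTheta D.DeltaTheta (σ : D.PiTemp) ee) := by
    rw [QuotientGroup.mk_mul, QuotientGroup.mk_pow, ← ContH1.conj_mk, ← ContH1.conj_mk, hee, hww]
    exact hy.symm
  obtain ⟨b, hb⟩ := ContH1.exists_coboundary_of_mk_eq _ _ hcl
  -- (iv) the root cocycle vs `ee` on `Π^tp_Ÿ̲̲`, up to a coboundary `∂b'`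
  have hrl : (QuotientGroup.mk (ContH1.resCocycle D.toTheta D.DeltaTheta (inf_le_left : C.GtpYdduu ≤ D.GtpYdd) ee) :
      D.H1 C.GtpYdduu) = QuotientGroup.mk (rootLift C) := by
    have h1 : (QuotientGroup.mk (rootLift C) : D.H1 C.GtpYdduu) = ContH1.mk (rootLift C).1 (rootLift C).2 := rfl
    rw [h1, rootLift_mk, ← hee]
    rfl
  obtain ⟨b', hb'⟩ := ContH1.exists_coboundary_of_mk_eq _ _ hrl
  -- the points involved
  set h : ↥C.GtpYdduu := toYdduu C ⊤ (MulAut.conjNormal σ⁻¹ g) with hh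
  set h₀ : ↥C.GtpYdduu := toYdduu C ⊤ (MulAut.conjNormal σ₀⁻¹ g) with hh₀
  have hgYdd : ((g : Pi C) : D.PiTemp) ∈ D.GtpYdd :=
    (inf_le_left : C.GtpYdduu ≤ D.GtpYdd) (Subgroup.mem_subgroupOf.mp (Subgroup.mem_inf.mp g.2).1)
  set kg : ↥D.GtpYdd := ⟨((g : Pi C) : D.PiTemp), hgYdd⟩ with hkg
  have hcoe : ∀ x : ↥(PiYdd C ⊓ ⊤), ((toYdduu C ⊤ x : ↥C.GtpYdduu) : D.PiTemp) = ((x : Pi C) : D.PiTemp) :=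
    fun _ => rfl
  have F1 : MulAut.conjNormal ((σ : D.PiTemp))⁻¹ kg =
      ⟨(h : D.PiTemp), (inf_le_left : C.GtpYdduu ≤ D.GtpYdd) h.2⟩ :=
    Subtype.ext (by
      simp only [MulAut.conjNormal_apply, hkg, hh, inv_inv, hcoe, Subgroup.coe_mul, Subgroup.coe_inv])
  have F1₀ : MulAut.conjNormal ((σ₀ : D.PiTemp))⁻¹ kg =
      ⟨(h₀ : D.PiTemp), (inf_le_left : C.GtpYdduu ≤ D.GtpYdd) h₀.2⟩ :=
    Subtype.ext (by
      simp only [MulAut.conjNormal_apply, hkg, hh₀, inv_inv, hcoe, Subgroup.coe_mul, Subgroup.coe_inv])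
  -- coboundaries of `Δ_Θ` are `M`-th powers at `g`
  have hg' : ∀ e : D.DeltaTheta, ∃ z : D.DeltaTheta,
      MulAut.conjNormal (D.toTheta ((g : Pi C) : D.PiTemp)) e * e⁻¹ = z ^ (M : ℕ) :=
    fun e => conj_mul_inv_eq_pow_deltaTheta C hO μ hg e
  -- conjugating the coboundary `∂b'` evaluated at `σ⁻¹gσ` by `θ(σ)` gives `∂(θ(σ)b')` at `g`
  have hconjD : ∀ τ : Pi C, ∀ (hτ : ↥C.GtpYdduu), (hτ : D.PiTemp) = (τ : D.PiTemp)⁻¹ * ((g : Pi C) : D.PiTemp) * τ →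
      MulAut.conjNormal (D.toTheta (τ : D.PiTemp))
          (MulAut.conjNormal (D.toTheta (hτ : D.PiTemp)) b' * b'⁻¹) =
        MulAut.conjNormal (D.toTheta ((g : Pi C) : D.PiTemp)) (MulAut.conjNormal (D.toTheta (τ : D.PiTemp)) b') *
          (MulAut.conjNormal (D.toTheta (τ : D.PiTemp)) b')⁻¹ := by
    intro τ hτ e
    rw [map_mul, map_inv, ← MulAut.mul_apply, ← MulAut.mul_apply, ← map_mul, ← map_mul, ← map_mul, ← map_mul, e]
    congr 3
    group
  have Hh : (h : D.PiTemp) = (σ : D.PiTemp)⁻¹ * ((g : Pi C) : D.PiTemp) * (σ : D.PiTemp) := by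
    simp only [hh, hcoe, MulAut.conjNormal_apply, Subgroup.coe_mul, Subgroup.coe_inv, inv_inv]
  have Hh₀ : (h₀ : D.PiTemp) = (σ₀ : D.PiTemp)⁻¹ * ((g : Pi C) : D.PiTemp) * (σ₀ : D.PiTemp) := by
    simp only [hh₀, hcoe, MulAut.conjNormal_apply, Subgroup.coe_mul, Subgroup.coe_inv, inv_inv]
  obtain ⟨z₁, hz₁⟩ := hg' (MulAut.conjNormal (D.toTheta (σ : D.PiTemp)) b')
  obtain ⟨z₂, hz₂⟩ := hg' (MulAut.conjNormal (D.toTheta (σ₀ : D.PiTemp)) b')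
  obtain ⟨z₃, hz₃⟩ := hg' b
  -- the two conjugate root values, in `Δ_Θ`
  have Eσ : Subgroup.inclusion (D.lDeltaTheta_le l)
        ((ContH1.conjCocycle (phi C) (D.lDeltaTheta l) σ (rootLiftCocycle C)).1 g) =
      (ContH1.conjCocycle D.toTheta D.DeltaTheta (σ : D.PiTemp) ee).1 kg * z₁ ^ (M : ℕ) := by
    rw [inclusion_conjCocycle_rootLiftCocycle_apply C hC, ← hh, hb' h, map_mul, ContH1.conjCocycle_apply, F1,
      hconjD σ h Hh, hz₁]
    rfl
  have Eσ₀ : Subgroup.inclusion (D.lDeltaTheta_le l)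
        ((ContH1.conjCocycle (phi C) (D.lDeltaTheta l) σ₀ (rootLiftCocycle C)).1 g) =
      (ContH1.conjCocycle D.toTheta D.DeltaTheta (σ₀ : D.PiTemp) ee).1 kg * z₂ ^ (M : ℕ) := by
    rw [inclusion_conjCocycle_rootLiftCocycle_apply C hC, ← hh₀, hb' h₀, map_mul, ContH1.conjCocycle_apply, F1₀,
      hconjD σ₀ h₀ Hh₀, hz₂]
    rfl
  -- the class identity at `kg`
  have Ecl : (ContH1.conjCocycle D.toTheta D.DeltaTheta (σ : D.PiTemp) ee).1 kg =
      (ContH1.conjCocycle D.toTheta D.DeltaTheta (σ₀ : D.PiTemp) ee).1 kg * (ww.1 kg) ^ (M : ℕ) * z₃ ^ (M : ℕ) := by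
    rw [hb kg, hz₃]
    rfl
  -- assemble: the quotient is an `M`-th power in `Δ_Θ`
  set Y : D.DeltaTheta := ww.1 kg * z₃ * z₁ * z₂⁻¹ with hY
  have hq : Subgroup.inclusion (D.lDeltaTheta_le l)
      (((ContH1.conjCocycle (phi C) (D.lDeltaTheta l) σ₀ (rootLiftCocycle C)).1 g)⁻¹ *
        (ContH1.conjCocycle (phi C) (D.lDeltaTheta l) σ (rootLiftCocycle C)).1 g) = Y ^ (M : ℕ) := by
    rw [map_mul, map_inv, Eσ, Eσ₀, Ecl, hY]
    apply (Additive.ofMul : D.DeltaTheta ≃ Additive D.DeltaTheta).injective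
    simp only [ofMul_mul, ofMul_inv, ofMul_pow]
    module
  -- hence an `N`-th power in `l·Δ_Θ`
  refine ⟨⟨(Y : D.GtpTheta) ^ l, Y, Y.2, rfl⟩, Subtype.ext ?_⟩
  have hq' := congrArg (fun a : D.DeltaTheta => (a : D.GtpTheta)) hq
  simp only [Subgroup.coe_inclusion, Subgroup.coe_pow] at hq'
  rw [powMonoidHom_apply, Subgroup.coe_pow, hq', hMN, pow_mul]

/-- **The `Π^tp_X̲̲`-orbit of the root cocycle `η̲̈^Θ` has FINITELY MANY MEMBERS modulo `N`-th powers on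
`Π^tp_Ÿ̲̲ ∩ chiKer(lN)`** — the input `hfin` of `IotaInvariantThetaInftyDivisible.lean`, from [EtTh] Prop. 1.5 (iii)
(`Prop15iii`, F-0591) and the finiteness of `O^×_K̈/(O^×_K̈)^{lN}` (`exists_finset_units_eq_mul_pow`): the invariant
`σ ↦ (a(σ) mod lN, the representative of u_σ)` takes finitely many values, and conjugates with the same invariant
agree modulo `N`-th powers (`conj_etaDd_eq_mul_pow`, `conj_rootLift_div_mem_range_pow`).
[cite: MochizukiEtTh2009, Prop 1.5 (iii) p.23] -/
theorem hfin_etaleThetaDataOfSetting' (hC : D.Compat) (hO : D.IsEtThOrigin) (h15 : ThetaSetting.Prop15iii E hC)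
    (mods : ∀ M : ℕ+, D.CyclotomeMod l M) (N : ℕ) (hN : 0 < N) :
    ∃ T : Finset (↥(PiYdd C ⊓ ⊤) → D.lDeltaTheta l), ∀ σ : Pi C, ∃ t ∈ T, ∀ g : ↥(PiYdd C ⊓ ⊤),
      haveI := piYdd_normal C hC
      (g : Pi C) ∈ chiKer C ⟨l * N, Nat.mul_pos (Nat.pos_of_ne_zero C.l_ne_zero) hN⟩ →
        (t g)⁻¹ * (ContH1.conjCocycle (phi C) (D.lDeltaTheta l) σ (rootLiftCocycle C)).1 g ∈
          (powMonoidHom N : D.lDeltaTheta l →* D.lDeltaTheta l).range := by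
  classical
  haveI := piYdd_normal C hC
  haveI := hC.GtpYdd_normal
  haveI := hC.GtpYddTheta_normal
  set M : ℕ+ := ⟨l * N, Nat.mul_pos (Nat.pos_of_ne_zero C.l_ne_zero) hN⟩ with hM
  haveI : NeZero (M : ℕ) := ⟨M.pos.ne'⟩
  -- [EtTh] Prop. 1.5 (iii): the lift `x'` of `η̈^Θ` and the units `u_σ`
  obtain ⟨x', hx', hΦ⟩ := E.exists_lift_conj_eq hC h15
  choose u hu hconj using hΦ
  -- finiteness of `O^×_K̈` modulo `M`-th powers
  haveI := D.finiteDimensional_K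
  haveI : FiniteDimensional ℚ_[p] (↥D.Kdd) := finiteDimensional_fieldKN D.K D.qX 2
  obtain ⟨S, hS1, hSrep⟩ := exists_finset_units_eq_mul_pow p (↥D.Kdd) (M := (M : ℕ)) M.pos
  have hu1 : ∀ τ : D.PiTemp, ‖((u τ : (↥D.Kdd)ˣ) : ↥D.Kdd)‖ = 1 := fun τ => hu τ
  choose s hsS v hv hsv using fun τ : D.PiTemp => hSrep _ (hu1 τ)
  have hs0 : ∀ τ, s τ ≠ 0 := fun τ => norm_pos_iff.mp (by rw [hS1 _ (hsS τ)]; exact one_pos)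
  have hv0 : ∀ τ, v τ ≠ 0 := fun τ => norm_pos_iff.mp (by rw [hv τ]; exact one_pos)
  have hunit : ∀ τ : D.PiTemp, u τ = Units.mk0 (s τ) (hs0 τ) * Units.mk0 (v τ) (hv0 τ) ^ (M : ℕ) := fun τ =>
    Units.ext (by rw [Units.val_mul, Units.val_pow_eq_pow_val, Units.val_mk0, Units.val_mk0]; exact hsv τ)
  -- the invariant `σ ↦ (a(σ) mod M, s(u_σ))` and one representative per value
  let inv : Pi C → ZMod (M : ℕ) × ↥D.Kdd := fun σ =>
    (((Multiplicative.toAdd (D.toZ (σ : D.PiTemp)) : ℤ) : ZMod (M : ℕ)), s (σ : D.PiTemp))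
  have hpick : ∀ q : ZMod (M : ℕ) × ↥D.Kdd, ∃ τ : Pi C, (∃ σ, inv σ = q) → inv τ = q := by
    intro q
    by_cases hq : ∃ σ, inv σ = q
    · obtain ⟨σ, hσ⟩ := hq
      exact ⟨σ, fun _ => hσ⟩
    · exact ⟨1, fun h' => (hq h').elim⟩
  choose pick hpick using hpick
  refine ⟨((Finset.univ : Finset (ZMod (M : ℕ))) ×ˢ S).image fun q =>
      (ContH1.conjCocycle (phi C) (D.lDeltaTheta l) (pick q) (rootLiftCocycle C)).1, fun σ => ?_⟩
  refine ⟨(ContH1.conjCocycle (phi C) (D.lDeltaTheta l) (pick (inv σ)) (rootLiftCocycle C)).1,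
    Finset.mem_image_of_mem _ (Finset.mem_product.mpr ⟨Finset.mem_univ _, hsS _⟩), fun g hg => ?_⟩
  -- the representative `σ₀ := pick (inv σ)` has the same invariant as `σ`
  set σ₀ : Pi C := pick (inv σ) with hσ₀
  have hinv : inv σ₀ = inv σ := hpick (inv σ) ⟨σ, rfl⟩
  have ha : (((Multiplicative.toAdd (D.toZ (σ₀ : D.PiTemp)) : ℤ) : ZMod (M : ℕ))) =
      ((Multiplicative.toAdd (D.toZ (σ : D.PiTemp)) : ℤ) : ZMod (M : ℕ)) := congrArg Prod.fst hinv
  have hs : s (σ₀ : D.PiTemp) = s (σ : D.PiTemp) := congrArg Prod.snd hinv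
  obtain ⟨k, hk⟩ := (ZMod.intCast_eq_intCast_iff_dvd_sub _ _ _).mp ha
  have hk' : Multiplicative.toAdd (D.toZ (σ : D.PiTemp)) =
      Multiplicative.toAdd (D.toZ (σ₀ : D.PiTemp)) + (M : ℕ) * k := by
    have : (((M : ℕ) : ℕ) : ℤ) = ((M : ℕ) : ℤ) := rfl
    linarith [hk]
  -- the units with the common representative `s σ`
  have huσ : u (σ : D.PiTemp) = Units.mk0 (s σ) (hs0 σ) * Units.mk0 (v σ) (hv0 σ) ^ (M : ℕ) := hunit σ
  have huσ₀ : u (σ₀ : D.PiTemp) = Units.mk0 (s σ) (hs0 σ) * Units.mk0 (v σ₀) (hv0 σ₀) ^ (M : ℕ) := by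
    rw [hunit σ₀]
    congr 1
    exact Units.ext (by rw [Units.val_mk0, Units.val_mk0, hs])
  obtain ⟨y, hy⟩ := conj_etaDd_eq_mul_pow (E := E) hC hx' hk' huσ huσ₀ (hconj σ) (hconj σ₀)
  exact conj_rootLift_div_mem_range_pow C hC hO (mods M) rfl y hy g hg

/-! ### (hdiv) and the «respectively» clause at the model -/

/-- **(hdiv) AT THE MODEL `D := etaleThetaDataOfSetting'`, PROVED** modulo named inputs: every class of `θ(Π_v)`
is divisible by every `N ≥ 1` in `lim_J H¹(Π_Ÿ(Π_v)|_J, (l·Δ_Θ)(Π_v))` — from F-0591 `Prop15iii`, the cyclotome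
identifications `mods`, the origin guard, and "`Δ_Θ` compact, `(Π^tp_X)^Θ` Hausdorff".
[claim: Mochizuki2012, status: disputed] (IUTchII §2 Prop 2.2 (ii), kurims p.66) -/
theorem hdiv_etaleThetaDataOfSetting' (hC : D.Compat) (hS : D.Sec2Hyps) (hO : D.IsEtThOrigin)
    (hΔ : IsCompact (D.DeltaTheta : Set D.GtpTheta)) [T2Space D.GtpTheta] (mods : ∀ M : ℕ+, D.CyclotomeMod l M)
    (h15 : ThetaSetting.Prop15iii E hC) (hchar : PiYddCharacteristic C) (S : BadPlaceSetting.{0}) (eS : (Pi C) ≃ₜ* S.PiX)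
    (hl : S.l = l) :
    ∀ t ∈ (etaleThetaDataOfSetting' C hC hS hchar S.toThetaSetting eS hl).theta, ∀ N : ℕ, 0 < N →
      ∃ x : (coh C).lim, N • x = (coh C).toLim ⊤ t :=
  hdiv_etaleThetaDataOfSetting'_of_finite C hC hS hO hΔ mods hchar S eS hl
    fun N hN => hfin_etaleThetaDataOfSetting' C hC hO h15 mods N hN

/-- **IUTchII:Prop2.2(ii)** «respectively» clause AT THE MODEL, (hdiv) DISCHARGED: `InftyClause` — `∞θ^ι(Π_v)` is
ONE `μ`-orbit within each `{(l·ℤ) × μ}`-orbit of `∞θ(Π_v)` and meets every level — holds for every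
`IotaInvariantTheta'` datum over `etaleThetaDataOfSetting'`, modulo ONLY: (hfix) [no element `≠ 1` of `(l·Δ_Θ)` is
fixed by a finite-index subgroup of `Π_Ÿ`; cyclotomic character — abc-iut-w4-d041], F-0591 `Prop15iii`, the L2
cyclotome identifications `CyclotomeMod`, the origin guard F-2498 `IsEtThOrigin`, and "`Δ_Θ` compact,
`(Π^tp_X)^Θ` Hausdorff" ([EtTh] p. 12). [claim: Mochizuki2012, status: disputed] (IUTchII §2 Prop 2.2 (ii), kurims p.66) -/
theorem inftyClause_etaleThetaDataOfSetting'_of_prop15iii (hC : D.Compat) (hS : D.Sec2Hyps) (hO : D.IsEtThOrigin)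
    (hΔ : IsCompact (D.DeltaTheta : Set D.GtpTheta)) [T2Space D.GtpTheta] (mods : ∀ M : ℕ+, D.CyclotomeMod l M)
    (h15 : ThetaSetting.Prop15iii E hC) (hchar : PiYddCharacteristic C) (S : BadPlaceSetting.{0}) (eS : (Pi C) ≃ₜ* S.PiX)
    (hl : S.l = l) {T : TemperedCoverings S (Pi C)}
    {Dec : SubgraphDecomposition S T (etaleThetaDataOfSetting' C hC hS hchar S.toThetaSetting eS hl)}
    (Θ : IotaInvariantTheta' Dec)
    (hfix : ∀ K' : Subgroup (Pi C), K'.FiniteIndex → ∀ a : ↥(D.lDeltaTheta l),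
      (∀ n : Pi C, n ∈ PiYdd C ⊓ K' → MulAut.conjNormal (phi C n) a = a) → a = 1) :
    Θ.InftyClause :=
  inftyClause_etaleThetaDataOfSetting' C hC hS hchar S eS hl Θ hfix
    (hdiv_etaleThetaDataOfSetting' C hC hS hO hΔ mods h15 hchar S eS hl)

end EtaleThetaDataOfSetting

end

end Literature.IUT.HodgeArakelov
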